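import Summits.AtomisticToContinuum.HydrodynamicLimit.Theorems.AntiMazurCoboundariesCorrectorPressureDecayKiferWallGibbsSanity
import Literature.MathematicalPhysics.KineticTheory.FluctuationSpace
import Summits.AtomisticToContinuum.HydrodynamicLimit.Theorems.MourreKoopmanChargesIdealGasNoDecay
import HarnessLib

/-!
# Maxwellian orthogonality under a hard-sphere DLR state (hypothesis B5 of `OneBodyCompleteness`)

Crux stmt-AtomisticToContinuum-9583 `…Theses.MourreKoopmanCharges.OneBodyCompleteness`, line `registered`, registered stub
`gibbsMaxwellianOrthogonality`: under a hard-sphere DLR state `μ` (`IsHardSphereGibbs σ z θ⁻¹ 0 μ`), the cell observable `A_h` of a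
continuous polynomially growing `h ⊥ {1, v, |v|²}` in `L²(M_θ)` is uncorrelated with every translate of the five cell charges.
Route (Alexander 1976 §2.1, as `…KiferWallGibbsSanity.lean` for the first moment): DLR for functions along the specification of a
window `Λ ⊇ [0,1)³ ∪ ([0,1)³ − x)`; given the boundary condition and the number `k` of thrown particles these are i.i.d.
`Leb|_Λ ⊗ 𝒩(0, θI)` weighted by a hard core depending on the POSITIONS only, so each term `1_C(qᵢ) 1_{C'}(qⱼ) h(vᵢ) e(vⱼ)` of the
product of two window sums has velocity factor `∫ h ∫ e = 0` (`i ≠ j`) or `∫ h e = 0` (`i = j`). Bochner junk is harmless: the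
identity is proved for a measurable representative, whose integral is `0` by definition when it is not integrable.
-/

noncomputable section

open MeasureTheory ProbabilityTheory Set Filter Topology Function
open scoped ENNReal

namespace Summit.AtomisticToContinuum.HydrodynamicLimit.Theorems.MourreKoopmanChargesOneBodyCompleteness

open Literature.Analysis.FluidPDE (IsHardSphereGibbs HardCoreIn superposeIn maxwellPhaseMeasure localMaxwellian)
open Literature.Analysis.FunctionSpaces (PointConfig)
open Literature.MathematicalPhysics.KineticTheory (V3 MarkedConfig gaussMeasure cellObs cellCharge chargeFn linStat unitCell
  spatialShift spatialShift_apply)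
open Summit.AtomisticToContinuum.HydrodynamicLimit.Theorems.KiferCompactification (posSum measurable_posSum posSum_superposeIn
  hardCoreIn_superposeIn_iff measurableSet_hardCoreIn_superposeIn_left maxwellPhaseMeasure_inv_eq_prod_gaussMeasure
  sigmaFinite_maxwellPhaseMeasure lintegral_eq_lintegral_gibbsSpecMeasure lintegral_gibbsSpecMeasure lintegral_gibbsWeightMeasure
  lintegral_count_le_of_isHardSphereGibbs tsum_ofReal_pow_div_factorial_mul_lt_top measurable_toENNReal_count)
open Summit.AtomisticToContinuum.HydrodynamicLimit.Theorems.MourreKoopmanChargesIdealGasNoDecay (integral_eval_pi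
  integrable_eval_pi indepFun_eval_pi integral_cross_eq_zero integrable_cross integrable_of_poly_growth
  integral_gaussMeasure_eq_integral_mul)

/-- **Position/velocity Fubini.** Under `(π ⊗ γ)^{⊗k}`, a measurable factor `|a| ≤ 1` that is a.e. a function of the positions,
times `h(vᵢ) f(vⱼ)` with `h, f, h f ∈ L¹(γ)`, `∫ h dγ = 0 = ∫ h f dγ`, is integrable with integral zero (independence / diagonal). -/
theorem integrable_integral_posFactor_mul {k : ℕ} (π γ : Measure V3) [IsProbabilityMeasure π] [IsProbabilityMeasure γ] {h f : V3 → ℝ}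
    (hh : Measurable h) (hf : Measurable f) (hhi : Integrable h γ) (hfi : Integrable f γ) (hhf : Integrable (fun v => h v * f v) γ)
    (h0 : ∫ v, h v ∂γ = 0) (hf0 : ∫ v, h v * f v ∂γ = 0) (i j : Fin k) {a : (Fin k → V3 × V3) → ℝ} {a' : (Fin k → V3) → ℝ}
    (ham : AEStronglyMeasurable a (Measure.pi fun _ : Fin k => π.prod γ)) (ha1 : ∀ x, ‖a x‖ ≤ 1)
    (hae : a =ᵐ[Measure.pi fun _ : Fin k => π.prod γ] fun x => a' (fun l => (x l).1)) :
    Integrable (fun x => a x * (h (x i).2 * f (x j).2)) (Measure.pi fun _ : Fin k => π.prod γ) ∧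
      ∫ x, a x * (h (x i).2 * f (x j).2) ∂(Measure.pi fun _ : Fin k => π.prod γ) = 0 := by
  have hmp := measurePreserving_arrowProdEquivProdArrow V3 V3 (Fin k) (fun _ => π) (fun _ => γ)
  have hV : Integrable (fun v : Fin k → V3 => h (v i) * f (v j)) (Measure.pi fun _ : Fin k => γ) ∧
      ∫ v, h (v i) * f (v j) ∂(Measure.pi fun _ : Fin k => γ) = 0 := by
    by_cases hij : i = j
    · subst hij
      exact ⟨integrable_eval_pi γ hhf i, (integral_eval_pi γ (fun y => h y * f y) (hh.mul hf) i).trans hf0⟩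
    · have hc : ∀ v : Fin k → V3, h (v i) * f (v j) = f (v j) * h (v i) := fun v => mul_comm _ _
      simp_rw [hc]
      exact ⟨integrable_cross γ f h hf hh hfi hhi (Ne.symm hij), integral_cross_eq_zero γ f h hf hh h0 (Ne.symm hij)⟩
  refine ⟨Integrable.bdd_mul ?_ ham (ae_of_all _ ha1), ?_⟩
  · have hG : Integrable (fun y : (Fin k → V3) × (Fin k → V3) => (1 : ℝ) * (h (y.2 i) * f (y.2 j)))
        ((Measure.pi fun _ : Fin k => π).prod (Measure.pi fun _ : Fin k => γ)) := (integrable_const (1 : ℝ)).mul_prod hV.1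
    simp only [one_mul] at hG
    exact (hmp.integrable_comp_emb (MeasurableEquiv.measurableEmbedding _)).2 hG
  have h1 : (fun x : Fin k → V3 × V3 => a x * (h (x i).2 * f (x j).2)) =ᵐ[Measure.pi fun _ : Fin k => π.prod γ]
      fun x => a' (fun l => (x l).1) * (h (x i).2 * f (x j).2) := hae.mono fun x hx => by simp only [hx]
  have h2 : ∫ x, a' (fun l => (x l).1) * (h (x i).2 * f (x j).2) ∂(Measure.pi fun _ : Fin k => π.prod γ) =
      ∫ y : (Fin k → V3) × (Fin k → V3), a' y.1 * (h (y.2 i) * f (y.2 j))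
        ∂((Measure.pi fun _ : Fin k => π).prod (Measure.pi fun _ : Fin k => γ)) :=
    hmp.integral_comp' (fun y : (Fin k → V3) × (Fin k → V3) => a' y.1 * (h (y.2 i) * f (y.2 j)))
  rw [integral_congr_ae h1, h2, integral_prod_mul (μ := Measure.pi fun _ : Fin k => π) (ν := Measure.pi fun _ : Fin k => γ)
    a' (fun v : Fin k → V3 => h (v i) * f (v j)), hV.2, mul_zero]

/-- Under `ρ^{⊗k}` (`ρ` a probability law on phase space whose position marginal charges neither `Λᶜ` nor points), a.s. all
positions lie in `Λ` and are pairwise distinct. -/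
theorem ae_pi_positions_good {ρ : Measure (V3 × V3)} [IsProbabilityMeasure ρ] {Λ : Set V3} (hout : ρ (Prod.fst ⁻¹' Λᶜ) = 0)
    (hfst : ∀ q : V3, ρ (Prod.fst ⁻¹' {q}) = 0) (k : ℕ) :
    ∀ᵐ x ∂(Measure.pi fun _ : Fin k => ρ), (∀ i, (x i).1 ∈ Λ) ∧ ∀ i j, (x i).1 = (x j).1 → i = j := by
  refine Filter.eventually_and.2 ⟨ae_all_iff.2 fun i => ?_, ae_all_iff.2 fun i => ae_all_iff.2 fun j => ?_⟩
  · rw [ae_iff]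
    exact Measure.pi_eval_preimage_null (fun _ : Fin k => ρ) (i := i) hout
  · by_cases hij : i = j
    · exact ae_of_all _ fun _ _ => hij
    · have hD : MeasurableSet {p : (V3 × V3) × (V3 × V3) | p.1.1 = p.2.1} := measurableSet_eq_fun measurable_fst.fst measurable_snd.fst
      have hpair : (Measure.pi fun _ : Fin k => ρ).map (fun x => (x i, x j)) = ρ.prod ρ := by
        rw [(indepFun_iff_map_prod_eq_prod_map_map (measurable_pi_apply i).aemeasurable
          (measurable_pi_apply j).aemeasurable).1 (indepFun_eval_pi ρ hij),
          (measurePreserving_eval (fun _ : Fin k => ρ) i).map_eq, (measurePreserving_eval (fun _ : Fin k => ρ) j).map_eq]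
      have hnull : (Measure.pi fun _ : Fin k => ρ) ((fun x => (x i, x j)) ⁻¹' {p : (V3 × V3) × (V3 × V3) | p.1.1 = p.2.1}) = 0 := by
        rw [← Measure.map_apply ((measurable_pi_apply i).prodMk (measurable_pi_apply j)) hD, hpair, Measure.prod_apply hD]
        refine (lintegral_congr fun a => ?_).trans lintegral_zero
        have : Prod.mk a ⁻¹' {p : (V3 × V3) × (V3 × V3) | p.1.1 = p.2.1} = Prod.fst ⁻¹' {a.1} := by
          ext b
          simp only [mem_preimage, mem_setOf_eq, mem_singleton_iff, eq_comm]
        rw [this, hfst]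
      rw [ae_iff]
      exact measure_mono_null (fun x hx => (Classical.not_imp.1 hx).1) hnull

/-- **Per-`k` identity on the hard-core event.** Under `(π ⊗ γ)^{⊗k}` (positions a.s. in `Λ` and distinct), for a functional
`Fr` of the superposition which on good superpositions is `(Σᵢ 1_C(qᵢ) h(vᵢ)) (Σⱼ 1_{C'}(qⱼ) e(vⱼ) − b)`, `∫ h dγ = 0 = ∫ h e dγ`,
the `[0, ∞]`-integrals over the hard-core event of the positive parts of `Fr` and `−Fr` coincide (integral zero there). -/
theorem setLIntegral_hardCore_ofReal_eq_neg {k : ℕ} {π γ : Measure V3} [IsProbabilityMeasure π] [IsProbabilityMeasure γ]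
    {Λ C C' : Set V3} (hΛ : MeasurableSet Λ) (hC : MeasurableSet C) (hC' : MeasurableSet C')
    (hout : (π.prod γ) (Prod.fst ⁻¹' Λᶜ) = 0) (hfst : ∀ q : V3, (π.prod γ) (Prod.fst ⁻¹' {q}) = 0)
    {h e : V3 → ℝ} (hh : Measurable h) (he : Measurable e) (hhi : Integrable h γ) (hei : Integrable e γ)
    (hhe : Integrable (fun v => h v * e v) γ) (h0 : ∫ v, h v ∂γ = 0) (he0 : ∫ v, h v * e v ∂γ = 0) (b σ : ℝ)
    (Y : PointConfig (V3 × V3)) {Fr : PointConfig (V3 × V3) → ℝ}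
    (hFr : ∀ x : Fin k → V3 × V3, (∀ i, (x i).1 ∈ Λ) → (∀ i j, (x i).1 = (x j).1 → i = j) → Fr (superposeIn Λ x Y) =
      (∑ i, C.indicator (1 : V3 → ℝ) (x i).1 * h (x i).2) * ((∑ j, C'.indicator (1 : V3 → ℝ) (x j).1 * e (x j).2) - b)) :
    ∫⁻ x in {x : Fin k → V3 × V3 | HardCoreIn σ Λ (superposeIn Λ x Y)}, ENNReal.ofReal (Fr (superposeIn Λ x Y))
        ∂(Measure.pi fun _ : Fin k => π.prod γ) =
      ∫⁻ x in {x : Fin k → V3 × V3 | HardCoreIn σ Λ (superposeIn Λ x Y)}, ENNReal.ofReal (-Fr (superposeIn Λ x Y))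
        ∂(Measure.pi fun _ : Fin k => π.prod γ) := by
  set P : Measure (Fin k → V3 × V3) := Measure.pi fun _ : Fin k => π.prod γ with hP
  set H : Set (Fin k → V3 × V3) := {x | HardCoreIn σ Λ (superposeIn Λ x Y)} with hH
  have hHm : MeasurableSet H := measurableSet_hardCoreIn_superposeIn_left σ hΛ k Y
  set Hq : Set (Fin k → V3) := {q | (∀ i j, i ≠ j → σ ≤ ‖q i - q j‖) ∧ ∀ i, ∀ p ∈ Y, p.1 ∉ Λ → σ ≤ ‖q i - p.1‖} with hHq
  have hgood : ∀ᵐ x ∂P, (∀ i, (x i).1 ∈ Λ) ∧ ∀ i j, (x i).1 = (x j).1 → i = j := ae_pi_positions_good hout hfst k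
  -- a.s. the hard core is a function of the positions
  have hHae : ∀ᵐ x ∂P, H.indicator (1 : (Fin k → V3 × V3) → ℝ) x = Hq.indicator 1 (fun l => (x l).1) := by
    filter_upwards [hgood] with x hx
    have hiff : x ∈ H ↔ (fun l => (x l).1) ∈ Hq := hardCoreIn_superposeIn_iff σ Λ hx.1 hx.2 Y
    by_cases hxH : x ∈ H
    · simp only [Set.indicator_of_mem hxH, Set.indicator_of_mem (hiff.1 hxH), Pi.one_apply]
    · simp only [Set.indicator_of_notMem hxH, Set.indicator_of_notMem (fun h' => hxH (hiff.2 h'))]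
  -- the generic term `1_H(x) 1_C(qᵢ) 1_D(qⱼ) · h(vᵢ) f(vⱼ)`: integrable, with integral zero
  have hterm : ∀ {f : V3 → ℝ} {D : Set V3}, Measurable f → Integrable f γ → Integrable (fun v => h v * f v) γ →
      ∫ v, h v * f v ∂γ = 0 → MeasurableSet D → ∀ i j : Fin k,
      Integrable (fun x => (H.indicator 1 x * C.indicator (1 : V3 → ℝ) (x i).1 * D.indicator (1 : V3 → ℝ) (x j).1) *
        (h (x i).2 * f (x j).2)) P ∧
      ∫ x, (H.indicator 1 x * C.indicator (1 : V3 → ℝ) (x i).1 * D.indicator (1 : V3 → ℝ) (x j).1) *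
        (h (x i).2 * f (x j).2) ∂P = 0 := by
    intro f D hf hfi hhf hf0 hD i j
    refine integrable_integral_posFactor_mul π γ hh hf hhi hfi hhf h0 hf0 i j
      ((((measurable_one.indicator hHm).mul ((measurable_one.indicator hC).comp (measurable_pi_apply i).fst)).mul
        ((measurable_one.indicator hD).comp (measurable_pi_apply j).fst))).aestronglyMeasurable (fun x => ?_)
      (a' := fun q => Hq.indicator 1 q * C.indicator (1 : V3 → ℝ) (q i) * D.indicator (1 : V3 → ℝ) (q j))
      (hHae.mono fun x hx => by simp only [hx])
    have hn1 : ∀ (s : Set (Fin k → V3 × V3)) y, ‖s.indicator (1 : (Fin k → V3 × V3) → ℝ) y‖ ≤ 1 := fun s y =>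
      (norm_indicator_le_norm_self _ _).trans (by simp)
    have hn2 : ∀ (s : Set V3) y, ‖s.indicator (1 : V3 → ℝ) y‖ ≤ 1 := fun s y => (norm_indicator_le_norm_self _ _).trans (by simp)
    rw [norm_mul, norm_mul]
    exact mul_le_one₀ (mul_le_one₀ (hn1 _ _) (norm_nonneg _) (hn2 _ _)) (norm_nonneg _) (hn2 _ _)
  -- the explicit product and its expansion on the hard-core event
  set Φ : (Fin k → V3 × V3) → ℝ := fun x =>
    (∑ i, C.indicator (1 : V3 → ℝ) (x i).1 * h (x i).2) * ((∑ j, C'.indicator (1 : V3 → ℝ) (x j).1 * e (x j).2) - b) with hΦ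
  set T : Fin k → Fin k → (Fin k → V3 × V3) → ℝ := fun i j x =>
    (H.indicator 1 x * C.indicator (1 : V3 → ℝ) (x i).1 * C'.indicator (1 : V3 → ℝ) (x j).1) * (h (x i).2 * e (x j).2) with hT
  set T' : Fin k → (Fin k → V3 × V3) → ℝ := fun i x =>
    (H.indicator 1 x * C.indicator (1 : V3 → ℝ) (x i).1 * (univ : Set V3).indicator (1 : V3 → ℝ) (x i).1) *
      (h (x i).2 * (fun _ : V3 => b) (x i).2) with hT'
  have hTi : ∀ i j, Integrable (T i j) P ∧ ∫ x, T i j x ∂P = 0 := fun i j => hterm he hei hhe he0 hC' i j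
  have hT'i : ∀ i, Integrable (T' i) P ∧ ∫ x, T' i x ∂P = 0 := fun i =>
    hterm measurable_const (integrable_const b) (hhi.mul_const b) (by simp only [integral_mul_const, h0, zero_mul])
      MeasurableSet.univ i i
  have hexp : ∀ x, H.indicator Φ x = ∑ i, ((∑ j, T i j x) - T' i x) := fun x => by
    by_cases hx : x ∈ H
    · simp only [hT, hT', hΦ, Set.indicator_of_mem hx, Set.indicator_of_mem (mem_univ _), Pi.one_apply, one_mul, mul_one]
      rw [Finset.sum_mul]
      refine Finset.sum_congr rfl fun i _ => ?_
      rw [mul_sub, Finset.mul_sum]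
      exact congrArg₂ _ (Finset.sum_congr rfl fun j _ => by ring) (by ring)
    · simp [hT, hT', Set.indicator_of_notMem hx]
  have hSi : ∀ i, Integrable (fun x => (∑ j, T i j x) - T' i x) P := fun i =>
    (integrable_finsetSum _ fun j _ => (hTi i j).1).sub' (hT'i i).1
  have hI0 : ∫ x in H, Φ x ∂P = 0 := by
    rw [← integral_indicator hHm]
    simp only [hexp]
    rw [integral_finsetSum _ fun i _ => hSi i]
    refine Finset.sum_eq_zero fun i _ => ?_
    rw [integral_sub (integrable_finsetSum _ fun j _ => (hTi i j).1) (hT'i i).1, integral_finsetSum _ fun j _ => (hTi i j).1,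
      (hT'i i).2, Finset.sum_eq_zero fun j _ => (hTi i j).2, sub_zero]
  -- hence the positive and negative parts of `Φ` have the same (finite) integral over `H`, and `Fr ∘ superposeIn =ᵐ Φ`
  have hIH : Integrable Φ (P.restrict H) :=
    (integrable_indicator_iff hHm).1 (by rw [funext hexp]; exact integrable_finsetSum _ fun i _ => hSi i)
  have hA : ∫⁻ x in H, ENNReal.ofReal (Φ x) ∂P ≠ ⊤ := hIH.lintegral_lt_top.ne
  have hB : ∫⁻ x in H, ENNReal.ofReal (-Φ x) ∂P ≠ ⊤ := hIH.neg.lintegral_lt_top.ne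
  have hAB : ∫⁻ x in H, ENNReal.ofReal (Φ x) ∂P = ∫⁻ x in H, ENNReal.ofReal (-Φ x) ∂P := by
    have key := integral_eq_lintegral_pos_part_sub_lintegral_neg_part hIH
    rw [hI0] at key
    exact (ENNReal.toReal_eq_toReal_iff' hA hB).1 (by linarith)
  have hFrae : ∀ᵐ x ∂(P.restrict H), Fr (superposeIn Λ x Y) = Φ x := ae_restrict_of_ae (hgood.mono fun x hx => hFr x hx.1 hx.2)
  calc ∫⁻ x in H, ENNReal.ofReal (Fr (superposeIn Λ x Y)) ∂P = ∫⁻ x in H, ENNReal.ofReal (Φ x) ∂P :=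
        lintegral_congr_ae (hFrae.mono fun x hx => by simp only [hx])
    _ = ∫⁻ x in H, ENNReal.ofReal (-Φ x) ∂P := hAB
    _ = ∫⁻ x in H, ENNReal.ofReal (-Fr (superposeIn Λ x Y)) ∂P := lintegral_congr_ae (hFrae.mono fun x hx => by simp only [hx])

/-- On a configuration with finitely many particles above `Λ`, the linear statistic of an observable vanishing off the cylinder
above `Λ` is the difference of its positive-part Campbell sums `posSum`. -/
theorem finsum_mem_eq_toReal_posSum_sub {u : V3 × V3 → ℝ} {Λ : Set V3} (hu0 : ∀ p, p.1 ∉ Λ → u p = 0)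
    {ω : PointConfig (V3 × V3)} (hfin : (ω.carrier ∩ Λ ×ˢ (univ : Set V3)).Finite) :
    ∑ᶠ p ∈ (ω : Set (V3 × V3)), u p = (posSum u ω).toReal - (posSum (fun p => -u p) ω).toReal := by
  classical
  set s := hfin.toFinset with hs
  have hmem : ∀ p, p ∈ s ↔ p ∈ (ω : Set (V3 × V3)) ∧ p.1 ∈ Λ := fun p => by
    rw [hs, hfin.mem_toFinset]
    simp
  have hsum : ∑ᶠ p ∈ (ω : Set (V3 × V3)), u p = ∑ p ∈ s, u p := by
    refine finsum_mem_eq_sum_of_subset u ?_ fun p hp => ((hmem p).1 (Finset.mem_coe.1 hp)).1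
    rintro p ⟨hp, hpu⟩
    refine Finset.mem_coe.2 ((hmem p).2 ⟨hp, ?_⟩)
    by_contra hΛ
    exact hpu (hu0 p hΛ)
  have htsum : ∀ w : V3 × V3 → ℝ, (∀ p, p.1 ∉ Λ → w p = 0) → posSum w ω = ∑ p ∈ s, ENNReal.ofReal (max (w p) 0) := by
    intro w hw0
    rw [posSum, tsum_subtype (ω : Set (V3 × V3)) fun p => ENNReal.ofReal (max (w p) 0), tsum_eq_sum (s := s) fun p hp => ?_]
    · exact Finset.sum_congr rfl fun p hp => Set.indicator_of_mem ((hmem p).1 hp).1 _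
    · by_cases hpω : p ∈ (ω : Set (V3 × V3))
      · rw [Set.indicator_of_mem hpω, hw0 p fun h' => hp ((hmem p).2 ⟨hpω, h'⟩), max_self, ENNReal.ofReal_zero]
      · exact Set.indicator_of_notMem hpω _
  rw [hsum, htsum u hu0, htsum (fun p => -u p) fun p hp => by rw [hu0 p hp, neg_zero],
    ENNReal.toReal_sum fun p _ => ENNReal.ofReal_ne_top, ENNReal.toReal_sum fun p _ => ENNReal.ofReal_ne_top, ← Finset.sum_sub_distrib]
  refine Finset.sum_congr rfl fun p _ => ?_
  rw [ENNReal.toReal_ofReal (le_max_right _ _), ENNReal.toReal_ofReal (le_max_right _ _)]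
  exact (max_zero_sub_max_neg_zero_eq_self (u p)).symm

/-- On a superposition whose thrown points are distinct with positions in `Λ`, the difference of the positive-part Campbell sums
of an observable vanishing off the cylinder above `Λ` is the sum over the thrown points. -/
theorem toReal_posSum_sub_superposeIn {u : V3 × V3 → ℝ} {Λ : Set V3} (hu0 : ∀ p, p.1 ∉ Λ → u p = 0) {k : ℕ}
    {x : Fin k → V3 × V3} (hx : ∀ i, (x i).1 ∈ Λ) (hinj : Function.Injective x) (Y : PointConfig (V3 × V3)) :
    (posSum u (superposeIn Λ x Y)).toReal - (posSum (fun p => -u p) (superposeIn Λ x Y)).toReal = ∑ i, u (x i) := by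
  rw [posSum_superposeIn hu0 hx hinj Y, posSum_superposeIn (fun p hp => by rw [hu0 p hp, neg_zero]) hx hinj Y,
    ENNReal.toReal_ofReal (Finset.sum_nonneg fun i _ => le_max_right _ _),
    ENNReal.toReal_ofReal (Finset.sum_nonneg fun i _ => le_max_right _ _), ← Finset.sum_sub_distrib]
  exact Finset.sum_congr rfl fun i _ => max_zero_sub_max_neg_zero_eq_self (u (x i))

/-- **Second-order Maxwellian orthogonality under a DLR state.** For a hard-sphere Gibbs state `μ` at inverse temperature `θ⁻¹`
(any diameter `σ`, activity `z > 0`), continuous `h, e` of polynomial growth with `∫ h dγ = 0` and `∫ h e dγ = 0` (`γ = 𝒩(0, θI)`),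
bounded measurable cells `C, C'` and a constant `b`: `E_μ[(Σ_{q ∈ C} h(v)) · (Σ_{q ∈ C'} e(v) − b)] = 0` (Bochner; `finsum`s). -/
theorem integral_windowStat_mul_sub_eq_zero {σ z θ : ℝ} (hz : 0 < z) (hθ : 0 < θ) {μ : Measure (PointConfig (V3 × V3))}
    (hG : IsHardSphereGibbs σ z θ⁻¹ (0 : V3) μ) {h e : V3 → ℝ} (hh : Continuous h) (he : Continuous e) {Ch Ce : ℝ} {kh ke : ℕ}
    (hhg : ∀ v, |h v| ≤ Ch * (1 + ‖v‖) ^ kh) (heg : ∀ v, |e v| ≤ Ce * (1 + ‖v‖) ^ ke) (h0 : ∫ v, h v ∂(gaussMeasure (0 : V3) θ) = 0)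
    (he0 : ∫ v, h v * e v ∂(gaussMeasure (0 : V3) θ) = 0) {C C' : Set V3} (hC : MeasurableSet C) (hC' : MeasurableSet C')
    (hCb : Bornology.IsBounded C) (hC'b : Bornology.IsBounded C') (b : ℝ) :
    ∫ ω, (∑ᶠ p ∈ (ω : Set (V3 × V3)), C.indicator (1 : V3 → ℝ) p.1 * h p.2) *
        ((∑ᶠ p ∈ (ω : Set (V3 × V3)), C'.indicator (1 : V3 → ℝ) p.1 * e p.2) - b) ∂μ = 0 := by
  classical
  haveI : IsProbabilityMeasure μ := hG.1
  -- the window `Λ` and the normalised one-particle law `π ⊗ γ`, `maxwellPhaseMeasure θ⁻¹ 0 Λ = |Λ| • π ⊗ γ`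
  set Λ : Set V3 := C ∪ C' ∪ Metric.ball (0 : V3) 1 with hΛdef
  have hΛ : MeasurableSet Λ := (hC.union hC').union measurableSet_ball
  have hΛb : Bornology.IsBounded Λ := (hCb.union hC'b).union Metric.isBounded_ball
  have hc0 : volume Λ ≠ 0 :=
    (lt_of_lt_of_le (Metric.measure_ball_pos volume (0 : V3) one_pos) (measure_mono subset_union_right)).ne'
  have hctop : volume Λ ≠ ⊤ := hΛb.measure_lt_top.ne
  set π : Measure V3 := (volume Λ)⁻¹ • volume.restrict Λ with hπ
  haveI hπ1 : IsProbabilityMeasure π :=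
    ⟨by rw [hπ, Measure.smul_apply, smul_eq_mul, Measure.restrict_apply_univ, ENNReal.inv_mul_cancel hc0 hctop]⟩
  have hmax : maxwellPhaseMeasure θ⁻¹ (0 : V3) Λ = volume Λ • π.prod (gaussMeasure (0 : V3) θ) := by
    rw [maxwellPhaseMeasure_inv_eq_prod_gaussMeasure hθ (0 : V3) Λ, ← Measure.prod_smul_left, hπ, smul_smul,
      ENNReal.mul_inv_cancel hc0 hctop, one_smul]
  have hpi : ∀ k : ℕ, Measure.pi (fun _ : Fin k => maxwellPhaseMeasure θ⁻¹ (0 : V3) Λ) =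
      volume Λ ^ k • Measure.pi (fun _ : Fin k => π.prod (gaussMeasure (0 : V3) θ)) := fun k => by
    haveI := sigmaFinite_maxwellPhaseMeasure θ⁻¹ (0 : V3) Λ
    refine Measure.pi_eq fun s _ => ?_
    rw [Measure.smul_apply, smul_eq_mul, Measure.pi_pi, hmax]
    simp only [Measure.smul_apply, smul_eq_mul]
    rw [Finset.prod_mul_distrib, Finset.prod_const, Finset.card_univ, Fintype.card_fin]
  have hout : (π.prod (gaussMeasure (0 : V3) θ)) (Prod.fst ⁻¹' Λᶜ) = 0 := by
    rw [← Set.prod_univ, Measure.prod_prod, hπ, Measure.smul_apply, smul_eq_mul, Measure.restrict_apply hΛ.compl,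
      Set.compl_inter_self, measure_empty, mul_zero, zero_mul]
  have hfst : ∀ q : V3, (π.prod (gaussMeasure (0 : V3) θ)) (Prod.fst ⁻¹' {q}) = 0 := fun q => by
    have h0' : (volume.restrict Λ) ({q} : Set V3) = 0 :=
      nonpos_iff_eq_zero.1 ((Measure.le_iff'.1 Measure.restrict_le_self {q}).trans_eq (measure_singleton q))
    rw [← Set.prod_univ, Measure.prod_prod, hπ, Measure.smul_apply, smul_eq_mul, h0', mul_zero, zero_mul]
  -- Gaussian integrability
  have hhi : Integrable h (gaussMeasure (0 : V3) θ) := integrable_of_poly_growth _ hh.aestronglyMeasurable hhg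
  have hei : Integrable e (gaussMeasure (0 : V3) θ) := integrable_of_poly_growth _ he.aestronglyMeasurable heg
  have hhe : Integrable (fun v => h v * e v) (gaussMeasure (0 : V3) θ) := by
    refine integrable_of_poly_growth _ (hh.mul he).aestronglyMeasurable (C := Ch * Ce) (k := kh + ke) fun v => ?_
    rw [abs_mul, pow_add, mul_mul_mul_comm]
    exact mul_le_mul (hhg v) (heg v) (abs_nonneg _) ((abs_nonneg _).trans (hhg v))
  -- the observables and their measurable representatives
  set u₁ : V3 × V3 → ℝ := fun p => C.indicator (1 : V3 → ℝ) p.1 * h p.2 with hu₁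
  set u₂ : V3 × V3 → ℝ := fun p => C'.indicator (1 : V3 → ℝ) p.1 * e p.2 with hu₂
  have hu₁m : Measurable u₁ := ((measurable_one.indicator hC).comp measurable_fst).mul (hh.measurable.comp measurable_snd)
  have hu₂m : Measurable u₂ := ((measurable_one.indicator hC').comp measurable_fst).mul (he.measurable.comp measurable_snd)
  have hu₁0 : ∀ p : V3 × V3, p.1 ∉ Λ → u₁ p = 0 := fun p hp => by
    simp only [hu₁, Set.indicator_of_notMem (fun h' => hp (subset_union_left (subset_union_left h'))), zero_mul]
  have hu₂0 : ∀ p : V3 × V3, p.1 ∉ Λ → u₂ p = 0 := fun p hp => by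
    simp only [hu₂, Set.indicator_of_notMem (fun h' => hp (subset_union_left (subset_union_right h'))), zero_mul]
  set Xr : PointConfig (V3 × V3) → ℝ := fun ω => (posSum u₁ ω).toReal - (posSum (fun p => -u₁ p) ω).toReal with hXr
  set Yr : PointConfig (V3 × V3) → ℝ := fun ω => (posSum u₂ ω).toReal - (posSum (fun p => -u₂ p) ω).toReal with hYr
  set Fr : PointConfig (V3 × V3) → ℝ := fun ω => Xr ω * (Yr ω - b) with hFr
  have hFm : Measurable Fr :=
    ((measurable_posSum hu₁m).ennreal_toReal.sub (measurable_posSum hu₁m.neg).ennreal_toReal).mul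
      (((measurable_posSum hu₂m).ennreal_toReal.sub (measurable_posSum hu₂m.neg).ennreal_toReal).sub measurable_const)
  have hFm' : Measurable fun ω => -Fr ω := hFm.neg
  -- a.s. finitely many particles above `Λ`, where the statistics agree with their representatives
  have hfinI : ∫⁻ ω, ((ω.count (Λ ×ˢ (univ : Set V3)) : ℕ∞) : ℝ≥0∞) ∂μ ≠ ⊤ := by
    refine ne_top_of_le_ne_top (tsum_ofReal_pow_div_factorial_mul_lt_top hz.le ?_).ne (lintegral_count_le_of_isHardSphereGibbs hG hΛ hΛb)
    rw [hmax, Measure.smul_apply, smul_eq_mul, measure_univ, mul_one]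
    exact hctop
  have hrep : (fun ω : PointConfig (V3 × V3) => (∑ᶠ p ∈ (ω : Set (V3 × V3)), u₁ p) * ((∑ᶠ p ∈ (ω : Set (V3 × V3)), u₂ p) - b))
      =ᵐ[μ] Fr := by
    filter_upwards [ae_lt_top (measurable_toENNReal_count (hΛ.prod MeasurableSet.univ)) hfinI] with ω hω
    rw [ENat.toENNReal_lt_top] at hω
    have hω' : (ω.carrier ∩ Λ ×ˢ (univ : Set V3)).Finite := Set.encard_lt_top_iff.1 hω
    rw [finsum_mem_eq_toReal_posSum_sub hu₁0 hω', finsum_mem_eq_toReal_posSum_sub hu₂0 hω']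
  show ∫ ω, (∑ᶠ p ∈ (ω : Set (V3 × V3)), u₁ p) * ((∑ᶠ p ∈ (ω : Set (V3 × V3)), u₂ p) - b) ∂μ = 0
  refine (integral_congr_ae hrep).trans ?_
  by_cases hint : Integrable Fr μ
  swap
  · exact integral_undef hint
  rw [integral_eq_lintegral_pos_part_sub_lintegral_neg_part hint, sub_eq_zero]
  congr 1
  -- DLR: both sides disintegrate along the specification of the window `Λ`, fibrewise equal
  rw [lintegral_eq_lintegral_gibbsSpecMeasure hG hΛ hΛb hFm.ennreal_ofReal.aemeasurable,
    lintegral_eq_lintegral_gibbsSpecMeasure hG hΛ hΛb hFm'.ennreal_ofReal.aemeasurable]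
  refine lintegral_congr fun Y => ?_
  rw [lintegral_gibbsSpecMeasure, lintegral_gibbsSpecMeasure, lintegral_gibbsWeightMeasure σ z θ⁻¹ (0 : V3) hΛ Y hFm.ennreal_ofReal,
    lintegral_gibbsWeightMeasure σ z θ⁻¹ (0 : V3) hΛ Y hFm'.ennreal_ofReal]
  congr 1
  refine tsum_congr fun k => ?_
  rw [hpi k, Measure.restrict_smul, lintegral_smul_measure, lintegral_smul_measure]
  congr 2
  refine setLIntegral_hardCore_ofReal_eq_neg hΛ hC hC' hout hfst hh.measurable he.measurable hhi hei hhe h0 he0 b σ Y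
    fun x hx hinj => ?_
  have hinj' : Function.Injective x := fun i j hij => hinj i j (by rw [hij])
  simp only [hFr, hXr, hYr]
  rw [toReal_posSum_sub_superposeIn hu₁0 hx hinj' Y, toReal_posSum_sub_superposeIn hu₂0 hx hinj' Y]

/-- The five charge functions are `1`, a coordinate, or `|v|²/2`. -/
theorem chargeFn_trichotomy (i : Fin 5) :
    chargeFn i = (fun _ => 1) ∨ (∃ j : Fin 3, chargeFn i = fun v => v j) ∨ chargeFn i = fun v => ‖v‖ ^ 2 / 2 := by
  fin_cases i
  exacts [Or.inl rfl, Or.inr (Or.inl ⟨0, rfl⟩), Or.inr (Or.inl ⟨1, rfl⟩), Or.inr (Or.inl ⟨2, rfl⟩), Or.inr (Or.inr rfl)]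

/-- The charge functions are continuous, of quadratic growth, and `h ⊥ {1, v, |v|²}` in `L²(M_θ)` gives `∫ h eᵢ M_θ = 0`. -/
theorem chargeFn_continuous_growth_orthogonal {θ : ℝ} {h : V3 → ℝ} (h1 : ∫ v, h v * localMaxwellian 1 θ (0 : V3) v = 0)
    (hv : ∀ i : Fin 3, ∫ v, h v * v i * localMaxwellian 1 θ (0 : V3) v = 0)
    (hE : ∫ v, h v * ‖v‖ ^ 2 * localMaxwellian 1 θ (0 : V3) v = 0) (i : Fin 5) :
    Continuous (chargeFn i) ∧ (∀ v, |chargeFn i v| ≤ 1 * (1 + ‖v‖) ^ 2) ∧ ∫ v, h v * chargeFn i v * localMaxwellian 1 θ (0 : V3) v = 0 := by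
  have hsq : ∀ v : V3, ‖v‖ ^ 2 ≤ 1 * (1 + ‖v‖) ^ 2 := fun v => by
    rw [one_mul]
    exact pow_le_pow_left₀ (norm_nonneg v) (le_add_of_nonneg_left zero_le_one) 2
  rcases chargeFn_trichotomy i with hi | ⟨j, hi⟩ | hi <;> rw [hi]
  · refine ⟨continuous_const, fun v => ?_, by simpa using h1⟩
    rw [abs_one, one_mul]
    exact one_le_pow₀ (le_add_of_nonneg_right (norm_nonneg v))
  · refine ⟨by fun_prop, fun v => ?_, hv j⟩
    have h1' : |v j| ≤ ‖v‖ := by rw [← Real.norm_eq_abs]; exact PiLp.norm_apply_le v j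
    nlinarith [hsq v, norm_nonneg v]
  · refine ⟨by fun_prop, fun v => ?_, ?_⟩
    · rw [abs_of_nonneg (by positivity)]
      linarith [hsq v, sq_nonneg ‖v‖]
    · have hfun : (fun v : V3 => h v * (‖v‖ ^ 2 / 2) * localMaxwellian 1 θ (0 : V3) v) =
          fun v => h v * ‖v‖ ^ 2 * localMaxwellian 1 θ (0 : V3) v / 2 := by
        funext v; ring
      rw [hfun, integral_div, hE, zero_div]

/-- **Registered stub `gibbsMaxwellianOrthogonality`** (hypothesis B5 "Maxwellian orthogonality under a DLR state" of the
framework stub of `OneBodyCompleteness`): under a hard-sphere DLR Gibbs state at inverse temperature `θ⁻¹`, the unit-cell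
observable of a continuous, polynomially growing `h` that is `M_θ`-orthogonal to `1, v, |v|²` is uncorrelated with every spatial
translate of the five cell charges. -/
theorem gibbsMaxwellianOrthogonality : ∀ σ z θ : ℝ, 0 < σ → 0 < z → 0 < θ → ∀ μ : MeasureTheory.Measure Literature.MathematicalPhysics.KineticTheory.MarkedConfig, Literature.Analysis.FluidPDE.IsHardSphereGibbs σ z θ⁻¹ (0 : Literature.MathematicalPhysics.KineticTheory.V3) μ → ∀ h : Literature.MathematicalPhysics.KineticTheory.V3 → ℝ, Continuous h → (∃ (C : ℝ) (k : ℕ), ∀ v, |h v| ≤ C * (1 + ‖v‖) ^ k) → (∫ v, h v * Literature.Analysis.FluidPDE.localMaxwellian 1 θ (0 : Literature.MathematicalPhysics.KineticTheory.V3) v = 0) → (∀ i : Fin 3, ∫ v, h v * v i * Literature.Analysis.FluidPDE.localMaxwellian 1 θ (0 : Literature.MathematicalPhysics.KineticTheory.V3) v = 0) → (∫ v, h v * ‖v‖ ^ 2 * Literature.Analysis.FluidPDE.localMaxwellian 1 θ (0 : Literature.MathematicalPhysics.KineticTheory.V3) v = 0) → ∀ (i : Fin 5) (x : Literature.MathematicalPhysics.KineticTheory.V3),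 cov[Literature.MathematicalPhysics.KineticTheory.cellObs h, Literature.MathematicalPhysics.KineticTheory.cellCharge i ∘ Literature.MathematicalPhysics.KineticTheory.spatialShift x; μ] = 0 := by
  intro σ z θ _hσ hz hθ μ hG h hh hgr h1 hv hE i x₀
  classical
  haveI : IsProbabilityMeasure μ := hG.1
  obtain ⟨Ch, kh, hhg⟩ := hgr
  obtain ⟨hec, heg, he1⟩ := chargeFn_continuous_growth_orthogonal h1 hv hE i
  have h0 : ∫ v, h v ∂(gaussMeasure (0 : V3) θ) = 0 := by rw [integral_gaussMeasure_eq_integral_mul hθ]; exact h1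
  have he0 : ∫ v, h v * chargeFn i v ∂(gaussMeasure (0 : V3) θ) = 0 := by rw [integral_gaussMeasure_eq_integral_mul hθ]; exact he1
  -- the cells `[0,1)³` and `[0,1)³ - x₀`
  have hcell : (unitCell : Set V3) = Literature.MathematicalPhysics.StatisticalMechanics.unitCube := rfl
  have hC : MeasurableSet (unitCell : Set V3) := hcell ▸ Literature.MathematicalPhysics.StatisticalMechanics.measurableSet_unitCube
  have hCb : Bornology.IsBounded (unitCell : Set V3) := hcell ▸ Literature.MathematicalPhysics.StatisticalMechanics.isBounded_unitCube
  have hC' : MeasurableSet ((· + x₀) ⁻¹' (unitCell : Set V3)) := hC.preimage (measurable_add_const x₀)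
  have hC'b : Bornology.IsBounded ((· + x₀) ⁻¹' (unitCell : Set V3)) := (isometry_add_right x₀).antilipschitz.isBounded_preimage hCb
  -- the two observables as linear statistics of product observables
  have hX : ∀ ω : MarkedConfig, cellObs h ω = ∑ᶠ p ∈ (ω : Set (V3 × V3)), (unitCell : Set V3).indicator (1 : V3 → ℝ) p.1 * h p.2 :=
    fun ω => by
    simp only [cellObs, linStat]
    refine finsum_mem_congr rfl fun p _ => ?_
    simp only [Set.indicator_apply, Pi.one_apply]
    split_ifs <;> simp
  have hY : ∀ ω : MarkedConfig, (cellCharge i ∘ spatialShift x₀) ω =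
      ∑ᶠ p ∈ (ω : Set (V3 × V3)), ((· + x₀) ⁻¹' (unitCell : Set V3)).indicator (1 : V3 → ℝ) p.1 * chargeFn i p.2 := fun ω => by
    simp only [Function.comp_apply, spatialShift_apply, cellCharge, cellObs, linStat, PointConfig.coe_eq_carrier,
      PointConfig.carrier_translate]
    rw [finsum_mem_image (add_left_injective _).injOn]
    refine finsum_mem_congr rfl fun p _ => ?_
    simp only [Prod.fst_add, Prod.snd_add, add_zero, Set.indicator_apply, Set.mem_preimage, Pi.one_apply]
    split_ifs <;> simp
  -- the mean of the cell observable vanishes (the case `e = 0`, `b = -1`), hence the covariance is a plain product moment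
  have hmean : μ[cellObs h] = 0 := by
    have key := integral_windowStat_mul_sub_eq_zero hz hθ hG hh continuous_const hhg (e := fun _ => (0 : ℝ)) (Ce := 1) (ke := 0)
      (fun v => by simp) h0 (by simp) hC hC hCb hCb (-1)
    simp only [mul_zero, finsum_mem_zero, zero_sub, neg_neg, mul_one] at key
    simp_rw [hX]
    exact key
  rw [ProbabilityTheory.covariance, hmean]
  simp_rw [sub_zero, hX, hY]
  exact integral_windowStat_mul_sub_eq_zero hz hθ hG hh hec hhg heg h0 he0 hC hC' hCb hC'b _

end Summit.AtomisticToContinuum.HydrodynamicLimit.Theorems.MourreKoopmanChargesOneBodyCompleteness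

end
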